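import Literature.Probability.RandomPlanarGeometry.HexSAWBrickWallStripFugacityWidthOneContactBoundaryLimit
import HarnessLib

/-!
# The Cramér transform of the contact-density pair: it is the extended rate on the closed triangle and `+∞` outside

Child module of `…ContactBoundaryLimit` / `…ContactBoundaryLDP` (the extended rate `J̄_{y,z}` on the closed density triangle `T̄`, the supporting
planes from interior tilts, the nearly optimal interior tilts at boundary points).  The CRAMÉR (Fenchel–Legendre) functional of the pair under
`P_{N,y,z}` at the multiplier tilt `(u,v) ∈ (0,∞)²` and the target `x = (x₁,x₂)` is
`Φ_{y,z}(x; u,v) = x₁ log u + x₂ log v − log(μ₁(yu,zv)/μ₁(y,z))` (the exponent of the exponential Chebyshev bound); its supremum over tilts is the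
textbook rate function `Λ*`.
* §1 growth of the sextic root: `s = μ₁(y,z)²` satisfies `s ≤ 2(y+z)` or `s³ ≤ 2yz`; hence `log μ₁(y,z) ≤ max(log(2(y+z))/2, log(2yz)/6)`;
* §2 ★★★★ **`Λ* = J̄` ON THE CLOSED TRIANGLE**: for `x ∈ T̄`, `J̄_{y,z}(x)` is the LEAST UPPER BOUND of `{Φ(x;u,v) : u, v > 0}` (attained iff `x ∈ T`);
* §3 ★★★★ **`Λ* = +∞` OFF THE CLOSED TRIANGLE**: if `x ∉ T̄` the functional is unbounded above (tilts `(e^t,e^t)`, `(e^{−4t},e^{−2t})`,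
  `(e^{−2t},e^{−4t})` and the growth bounds of §1) — the effective domain of the Cramér transform is EXACTLY `T̄`.
So the lineage's rate function (`J̃` inside, `J̄` on the boundary, nothing outside) IS the Cramér–Gärtner–Ellis rate function of the pair.

## Sources
DemboZeitouni2010 §2.2 Definition 2.2.2 / Theorem 2.2.30 and §2.3 (Gärtner–Ellis: the Fenchel–Legendre transform and its effective domain);
JansevanRensburg2000 §3.2–§3.3 (1st ed., OUP 2000).  Nothing quoted AS PRINTED; statements are this lineage's.
-/

noncomputable section

open Filter Topology Finset Literature.Probability.LatticeModels Literature.Probability.Percolation SimpleGraph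

namespace Literature.Probability.RandomPlanarGeometry.SAW.HexBW

open WidthOneYZ Real

variable {y z : ℝ}

/-! ## §1 Growth of the sextic root -/

/-- **Growth of `s = μ₁(y,z)²`**: `s ≤ 2(y+z)` or `s³ ≤ 2yz` (from the sextic law `s³ = (y+z)s² − yz·s + yz ≤ (y+z)s² + yz`).
[cite: BeatonBousquetMelouDeGierDuminilCopinGuttmann2014, §3.2 Proposition 6 (arXiv v5 p. 10; lane estimate on the tree's sextic law)] -/
theorem stripMuY₂_one_sq_growth (hy : 0 < y) (hz : 0 < z) :
    stripMuY₂ 1 y z ^ 2 ≤ 2 * (y + z) ∨ (stripMuY₂ 1 y z ^ 2) ^ 3 ≤ 2 * (y * z) := by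
  set s := stripMuY₂ 1 y z ^ 2 with hs
  have hlaw := stripMuY₂_one_sq_poly_eq hy hz
  have hmax := max_lt_stripMuY₂_one_sq hy hz
  rw [← hs] at hlaw hmax
  have hsy : y < s := lt_of_le_of_lt (le_max_left _ _) hmax
  have hs0 : 0 < s := hy.trans hsy
  have hcube : s ^ 3 ≤ (y + z) * s ^ 2 + y * z := by nlinarith [mul_pos (mul_pos hy hz) hs0]
  by_cases h : s ≤ 2 * (y + z)
  · exact Or.inl h
  · right
    push Not at h
    -- `(y+z) s² < s³/2`
    have : (y + z) * s ^ 2 < s ^ 3 / 2 := by nlinarith [pow_pos hs0 2]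
    linarith

/-- **Logarithmic growth**: `log μ₁(y,z) ≤ max(log(2(y+z))/2, log(2yz)/6)` for `y, z > 0`.
[cite: BeatonBousquetMelouDeGierDuminilCopinGuttmann2014, §3.2 Proposition 6 (arXiv v5 p. 10; lane estimate)] -/
theorem log_stripMuY₂_one_le_max (hy : 0 < y) (hz : 0 < z) :
    Real.log (stripMuY₂ 1 y z) ≤ max (Real.log (2 * (y + z)) / 2) (Real.log (2 * (y * z)) / 6) := by
  have hμ := stripMuY₂_pos 1 hy hz
  have hlog2 : Real.log (stripMuY₂ 1 y z) = Real.log (stripMuY₂ 1 y z ^ 2) / 2 := by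
    rw [Real.log_pow]; push_cast; ring
  rcases stripMuY₂_one_sq_growth hy hz with h | h
  · refine le_trans ?_ (le_max_left _ _)
    rw [hlog2]
    exact div_le_div_of_nonneg_right (Real.log_le_log (pow_pos hμ 2) h) (by norm_num)
  · refine le_trans ?_ (le_max_right _ _)
    have h3 : Real.log ((stripMuY₂ 1 y z ^ 2) ^ 3) ≤ Real.log (2 * (y * z)) := Real.log_le_log (pow_pos (pow_pos hμ 2) 3) h
    rw [Real.log_pow, Real.log_pow] at h3
    push_cast at h3
    have : Real.log (stripMuY₂ 1 y z) = (3 * (2 * Real.log (stripMuY₂ 1 y z))) / 6 := by ring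
    rw [this]
    exact div_le_div_of_nonneg_right h3 (by norm_num)

/-! ## §2 The Cramér transform equals the extended rate on the closed triangle -/

/-- ★★ **Every tilt is below the extended rate**: for `x ∈ T̄` and `u, v > 0`,
`x₁ log u + x₂ log v − log(μ₁(yu,zv)/μ₁(y,z)) ≤ J̄_{y,z}(x)` (the supporting plane of `…BoundaryLimit` at the interior pair typical under
`(yu, zv)`). [cite: DemboZeitouni2010, §2.2 Theorem 2.2.30 (exponential Chebyshev bound ≤ rate); JansevanRensburg2000, §3.2 (1st ed.; lane statement)] -/
theorem legendre_le_rateExt (hy : 0 < y) (hz : 0 < z) {x₁ x₂ : ℝ} (h1 : x₁ + x₂ ≤ 1 / 2) (h2 : 1 ≤ 4 * x₁ + 2 * x₂)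
    (h3 : 1 ≤ 2 * x₁ + 4 * x₂) {u v : ℝ} (hu : 0 < u) (hv : 0 < v) :
    x₁ * Real.log u + x₂ * Real.log v - Real.log (stripMuY₂ 1 (y * u) (z * v) / stripMuY₂ 1 y z) ≤
      Real.log (stripMuY₂ 1 y z) - x₁ * Real.log y - x₂ * Real.log z -
        (negMulLog (1 - 2 * x₁ - 2 * x₂) +
          (negMulLog (4 * x₁ + 2 * x₂ - 1) + negMulLog (2 * x₁ + 4 * x₂ - 1) - negMulLog (2 * x₁) - negMulLog (2 * x₂)) / 2) := by
  have hyu : 0 < y * u := mul_pos hy hu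
  have hzv : 0 < z * v := mul_pos hz hv
  obtain ⟨t1, t2, t3⟩ := contactB_mem_triangle hyu hzv
  obtain ⟨eY, eZ⟩ := eosY_contactB hyu hzv
  have h := tilt_inner_le_rateExt_sub hy hz t1 t2 t3 h1 h2 h3
  rw [eY, eZ, mul_div_cancel_left₀ _ hy.ne', mul_div_cancel_left₀ _ hz.ne'] at h
  -- `J̃` at the pair typical under `(yu,zv)` is `b log u + b' log v − log(μ₁(yu,zv)/μ₁(y,z))`
  have hJ : jointRate y z (y * u) (z * v) =
      contactB (y * u) (z * v) * Real.log u + contactB (z * v) (y * u) * Real.log v -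
        Real.log (stripMuY₂ 1 (y * u) (z * v) / stripMuY₂ 1 y z) := by
    unfold jointRate; rw [mul_div_cancel_left₀ _ hy.ne', mul_div_cancel_left₀ _ hz.ne']
  rw [hJ] at h
  linarith

/-- ★★★★ **`Λ* = J̄` ON THE CLOSED TRIANGLE**: for `y, z > 0` and `x ∈ T̄`, the extended rate `J̄_{y,z}(x)` is the least upper bound of the
Cramér functional `{x₁ log u + x₂ log v − log(μ₁(yu,zv)/μ₁(y,z)) : u, v > 0}` — the lineage's rate function is the Fenchel–Legendre
transform of the free energy (attained at the tilt `(Y(x)/y, Y'(x)/z)` when `x ∈ T`, only approached when `x ∈ ∂T`).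
[cite: DemboZeitouni2010, §2.2 Definition 2.2.2 and Theorem 2.2.30 (lane statement); JansevanRensburg2000, §3.2 Theorems 3.18–3.19 (1st ed., pp. 51–52)] -/
theorem isLUB_legendre_rateExt (hy : 0 < y) (hz : 0 < z) {x₁ x₂ : ℝ} (h1 : x₁ + x₂ ≤ 1 / 2) (h2 : 1 ≤ 4 * x₁ + 2 * x₂)
    (h3 : 1 ≤ 2 * x₁ + 4 * x₂) :
    IsLUB {r : ℝ | ∃ u v : ℝ, 0 < u ∧ 0 < v ∧
      r = x₁ * Real.log u + x₂ * Real.log v - Real.log (stripMuY₂ 1 (y * u) (z * v) / stripMuY₂ 1 y z)}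
      (Real.log (stripMuY₂ 1 y z) - x₁ * Real.log y - x₂ * Real.log z -
        (negMulLog (1 - 2 * x₁ - 2 * x₂) +
          (negMulLog (4 * x₁ + 2 * x₂ - 1) + negMulLog (2 * x₁ + 4 * x₂ - 1) - negMulLog (2 * x₁) - negMulLog (2 * x₂)) / 2)) := by
  refine ⟨?_, fun B hB => ?_⟩
  · rintro r ⟨u, v, hu, hv, rfl⟩
    exact legendre_le_rateExt hy hz h1 h2 h3 hu hv
  · -- approach from interior tilts
    by_contra hlt
    push Not at hlt
    set J := Real.log (stripMuY₂ 1 y z) - x₁ * Real.log y - x₂ * Real.log z -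
        (negMulLog (1 - 2 * x₁ - 2 * x₂) +
          (negMulLog (4 * x₁ + 2 * x₂ - 1) + negMulLog (2 * x₁ + 4 * x₂ - 1) - negMulLog (2 * x₁) - negMulLog (2 * x₂)) / 2) with hJ
    have hε : 0 < (J - B) / 2 := by linarith
    obtain ⟨a, a', k1, k2, k3, hge⟩ := exists_interior_tilt_ge hy hz h1 h2 h3 hε
    obtain ⟨hY0, hZ0, hb, hb', -, -⟩ := contactB_eosY k1 k2 k3
    -- the tilt `(u,v) = (Y/y, Y'/z)` realises the affine minorant at `(a,a')`
    have hmem : jointRate y z (eosY a a') (eosY a' a) + Real.log (eosY a a' / y) * (x₁ - a) +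
        Real.log (eosY a' a / z) * (x₂ - a') ∈ {r : ℝ | ∃ u v : ℝ, 0 < u ∧ 0 < v ∧
          r = x₁ * Real.log u + x₂ * Real.log v - Real.log (stripMuY₂ 1 (y * u) (z * v) / stripMuY₂ 1 y z)} := by
      refine ⟨eosY a a' / y, eosY a' a / z, div_pos hY0 hy, div_pos hZ0 hz, ?_⟩
      unfold jointRate
      rw [hb, hb', mul_div_cancel₀ _ hy.ne', mul_div_cancel₀ _ hz.ne']
      ring
    have := hB hmem
    rw [← hJ] at hge
    linarith

/-! ## §3 Off the closed triangle the Cramér transform is `+∞` -/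

/-- A uniform logarithmic bound: `log μ₁(y,z) ≤ |log(2(y+z))|/2 + |log(2yz)|/6`. [cite: BeatonBousquetMelouDeGierDuminilCopinGuttmann2014, §3.2 Proposition 6 (arXiv v5 p. 10; lane estimate)] -/
theorem log_stripMuY₂_one_le_abs (hy : 0 < y) (hz : 0 < z) :
    Real.log (stripMuY₂ 1 y z) ≤ |Real.log (2 * (y + z))| / 2 + |Real.log (2 * (y * z))| / 6 := by
  have h := log_stripMuY₂_one_le_max hy hz
  have a1 := le_abs_self (Real.log (2 * (y + z)))
  have a2 := le_abs_self (Real.log (2 * (y * z)))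
  have b1 := abs_nonneg (Real.log (2 * (y + z)))
  have b2 := abs_nonneg (Real.log (2 * (y * z)))
  rcases le_max_iff.1 h with h | h <;> linarith

/-- Case `x₁ + x₂ > ½` (beyond the adsorbed edge): the diagonal tilts `(e^t, e^t)` make the Cramér functional arbitrarily large.
[cite: DemboZeitouni2010, §2.3 (effective domain of Λ*; lane statement)] -/
theorem legendre_unbounded_adsorbed (hy : 0 < y) (hz : 0 < z) {x₁ x₂ : ℝ} (hx : 1 / 2 < x₁ + x₂) (K : ℝ) :
    ∃ u v : ℝ, 0 < u ∧ 0 < v ∧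
      K ≤ x₁ * Real.log u + x₂ * Real.log v - Real.log (stripMuY₂ 1 (y * u) (z * v) / stripMuY₂ 1 y z) := by
  set C := |Real.log (2 * (y + z))| / 2 + |Real.log (2 * (y * z))| / 6 with hC
  set L := Real.log (stripMuY₂ 1 y z) - C with hL
  set δ := x₁ + x₂ - 1 / 2 with hδ
  have hδ0 : 0 < δ := by rw [hδ]; linarith
  set t := max 0 ((K - L) / δ) with ht
  have ht0 : 0 ≤ t := le_max_left _ _
  have htK : (K - L) / δ ≤ t := le_max_right _ _
  refine ⟨Real.exp t, Real.exp t, Real.exp_pos t, Real.exp_pos t, ?_⟩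
  have hyu : 0 < y * Real.exp t := mul_pos hy (Real.exp_pos t)
  have hzv : 0 < z * Real.exp t := mul_pos hz (Real.exp_pos t)
  -- growth bound at the tilted fugacities
  have hμ' := log_stripMuY₂_one_le_max hyu hzv
  have e1 : Real.log (2 * (y * Real.exp t + z * Real.exp t)) = Real.log (2 * (y + z)) + t := by
    rw [show 2 * (y * Real.exp t + z * Real.exp t) = (2 * (y + z)) * Real.exp t by ring,
      Real.log_mul (by positivity) (Real.exp_pos t).ne', Real.log_exp]
  have e2 : Real.log (2 * (y * Real.exp t * (z * Real.exp t))) = Real.log (2 * (y * z)) + (t + t) := by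
    rw [show 2 * (y * Real.exp t * (z * Real.exp t)) = (2 * (y * z)) * (Real.exp t * Real.exp t) by ring,
      Real.log_mul (by positivity) (by positivity), Real.log_mul (Real.exp_pos t).ne' (Real.exp_pos t).ne', Real.log_exp]
  rw [e1, e2] at hμ'
  have hbound : Real.log (stripMuY₂ 1 (y * Real.exp t) (z * Real.exp t)) ≤ C + t / 2 := by
    have a1 := le_abs_self (Real.log (2 * (y + z)))
    have a2 := le_abs_self (Real.log (2 * (y * z)))
    rcases le_max_iff.1 hμ' with h | h
    · rw [hC]; linarith [abs_nonneg (Real.log (2 * (y * z)))]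
    · rw [hC]; linarith [abs_nonneg (Real.log (2 * (y + z)))]
  rw [Real.log_div (stripMuY₂_pos 1 hyu hzv).ne' (stripMuY₂_pos 1 hy hz).ne', Real.log_exp]
  -- `t·δ ≥ K − L`
  have hKL : K - L ≤ t * δ := by
    have := mul_le_mul_of_nonneg_right htK hδ0.le
    rwa [div_mul_cancel₀ _ hδ0.ne'] at this
  rw [hδ] at hKL; rw [hL] at hKL
  nlinarith [hbound, hKL, ht0]

/-- Case `4x₁ + 2x₂ < 1` (beyond the repelling edge): the tilts `(e^{−4t}, e^{−2t})` make the Cramér functional arbitrarily large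
(as both fugacities tend to `0` the free energy is `(log y + log z)/6 + O(1)` — the zigzag energy).
[cite: DemboZeitouni2010, §2.3 (effective domain of Λ*; lane statement)] -/
theorem legendre_unbounded_repelling (hy : 0 < y) (hz : 0 < z) {x₁ x₂ : ℝ} (hx : 4 * x₁ + 2 * x₂ < 1) (K : ℝ) :
    ∃ u v : ℝ, 0 < u ∧ 0 < v ∧
      K ≤ x₁ * Real.log u + x₂ * Real.log v - Real.log (stripMuY₂ 1 (y * u) (z * v) / stripMuY₂ 1 y z) := by
  set C := |Real.log (2 * (y + z))| / 2 + |Real.log (2 * (y * z))| / 6 with hC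
  set L := Real.log (stripMuY₂ 1 y z) - C with hL
  set δ := 1 - 4 * x₁ - 2 * x₂ with hδ
  have hδ0 : 0 < δ := by rw [hδ]; linarith
  set t := max 0 ((K - L) / δ) with ht
  have ht0 : 0 ≤ t := le_max_left _ _
  have htK : (K - L) / δ ≤ t := le_max_right _ _
  refine ⟨Real.exp (-4 * t), Real.exp (-2 * t), Real.exp_pos _, Real.exp_pos _, ?_⟩
  have hyu : 0 < y * Real.exp (-4 * t) := mul_pos hy (Real.exp_pos _)
  have hzv : 0 < z * Real.exp (-2 * t) := mul_pos hz (Real.exp_pos _)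
  have hμ' := log_stripMuY₂_one_le_max hyu hzv
  -- `y e^{-4t} + z e^{-2t} ≤ (y+z) e^{-2t}` and the product is `yz e^{-6t}`
  have hexp : Real.exp (-4 * t) ≤ Real.exp (-2 * t) := Real.exp_le_exp.2 (by linarith)
  have hsum : 2 * (y * Real.exp (-4 * t) + z * Real.exp (-2 * t)) ≤ (2 * (y + z)) * Real.exp (-2 * t) := by
    nlinarith [mul_le_mul_of_nonneg_left hexp hy.le]
  have e1 : Real.log (2 * (y * Real.exp (-4 * t) + z * Real.exp (-2 * t))) ≤ Real.log (2 * (y + z)) + -2 * t := by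
    have := Real.log_le_log (by positivity) hsum
    rwa [Real.log_mul (by positivity) (Real.exp_pos _).ne', Real.log_exp] at this
  have e2 : Real.log (2 * (y * Real.exp (-4 * t) * (z * Real.exp (-2 * t)))) = Real.log (2 * (y * z)) + (-4 * t + -2 * t) := by
    rw [show 2 * (y * Real.exp (-4 * t) * (z * Real.exp (-2 * t))) = (2 * (y * z)) * (Real.exp (-4 * t) * Real.exp (-2 * t)) by ring,
      Real.log_mul (by positivity) (by positivity), Real.log_mul (Real.exp_pos _).ne' (Real.exp_pos _).ne', Real.log_exp, Real.log_exp]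
  have hbound : Real.log (stripMuY₂ 1 (y * Real.exp (-4 * t)) (z * Real.exp (-2 * t))) ≤ C - t := by
    have a1 := le_abs_self (Real.log (2 * (y + z)))
    have a2 := le_abs_self (Real.log (2 * (y * z)))
    rcases le_max_iff.1 hμ' with h | h
    · have h' := div_le_div_of_nonneg_right e1 (by norm_num : (0:ℝ) ≤ 2)
      rw [hC]; linarith [abs_nonneg (Real.log (2 * (y * z)))]
    · rw [e2] at h
      rw [hC]; linarith [abs_nonneg (Real.log (2 * (y + z)))]
  rw [Real.log_div (stripMuY₂_pos 1 hyu hzv).ne' (stripMuY₂_pos 1 hy hz).ne', Real.log_exp, Real.log_exp]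
  have hKL : K - L ≤ t * δ := by
    have := mul_le_mul_of_nonneg_right htK hδ0.le
    rwa [div_mul_cancel₀ _ hδ0.ne'] at this
  rw [hδ] at hKL; rw [hL] at hKL
  nlinarith [hbound, hKL, ht0]

/-- Case `2x₁ + 4x₂ < 1` (beyond the mirror repelling edge): the tilts `(e^{−2t}, e^{−4t})`.
[cite: DemboZeitouni2010, §2.3 (effective domain of Λ*; lane statement)] -/
theorem legendre_unbounded_repelling' (hy : 0 < y) (hz : 0 < z) {x₁ x₂ : ℝ} (hx : 2 * x₁ + 4 * x₂ < 1) (K : ℝ) :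
    ∃ u v : ℝ, 0 < u ∧ 0 < v ∧
      K ≤ x₁ * Real.log u + x₂ * Real.log v - Real.log (stripMuY₂ 1 (y * u) (z * v) / stripMuY₂ 1 y z) := by
  -- swap the walls: `μ₁(y u, z v) = μ₁(z v, y u)`
  obtain ⟨v, u, hv, hu, h⟩ := legendre_unbounded_repelling hz hy (x₁ := x₂) (x₂ := x₁) (by linarith) K
  refine ⟨u, v, hu, hv, ?_⟩
  rw [stripMuY₂_symm 1 (y * u) (z * v), stripMuY₂_symm 1 y z]
  linarith

/-- ★★★★ **THE EFFECTIVE DOMAIN OF THE CRAMÉR TRANSFORM IS EXACTLY THE CLOSED TRIANGLE**: for `y, z > 0` and `x ∉ T̄` the Cramér functional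
`(u,v) ↦ x₁ log u + x₂ log v − log(μ₁(yu,zv)/μ₁(y,z))` is unbounded above (`Λ*(x) = +∞`): no density pair outside `T̄` has finite cost, and
(with `isLUB_legendre_rateExt`) the rate function of the lineage — `J̃` on `T`, `J̄` on `∂T`, `+∞` outside — is the Fenchel–Legendre transform
of the two-wall free energy. [cite: DemboZeitouni2010, §2.2 Theorem 2.2.30 and §2.3 (Gärtner–Ellis; lane statement); JansevanRensburg2000, §3.3 (1st ed.)] -/
theorem legendre_unbounded_of_not_mem_closed (hy : 0 < y) (hz : 0 < z) {x₁ x₂ : ℝ}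
    (hx : ¬ (x₁ + x₂ ≤ 1 / 2 ∧ 1 ≤ 4 * x₁ + 2 * x₂ ∧ 1 ≤ 2 * x₁ + 4 * x₂)) (K : ℝ) :
    ∃ u v : ℝ, 0 < u ∧ 0 < v ∧
      K ≤ x₁ * Real.log u + x₂ * Real.log v - Real.log (stripMuY₂ 1 (y * u) (z * v) / stripMuY₂ 1 y z) := by
  by_cases h1 : x₁ + x₂ ≤ 1 / 2
  · by_cases h2 : 1 ≤ 4 * x₁ + 2 * x₂
    · have h3 : ¬ (1 ≤ 2 * x₁ + 4 * x₂) := fun h3 => hx ⟨h1, h2, h3⟩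
      exact legendre_unbounded_repelling' hy hz (by linarith [not_le.1 h3]) K
    · exact legendre_unbounded_repelling hy hz (by linarith [not_le.1 h2]) K
  · exact legendre_unbounded_adsorbed hy hz (by linarith [not_le.1 h1]) K

end Literature.Probability.RandomPlanarGeometry.SAW.HexBW
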